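import Literature.AlgebraicGeometry.Resolution.LogRegularEquivariantIdeal
import Literature.AlgebraicGeometry.Resolution.LogRegularAtlasGluing
import Literature.AlgebraicGeometry.Resolution.LogRegularEquivariantResolution
import Literature.AlgebraicGeometry.Resolution.BlowupsEquivariant
import HarnessLib

/-!
# Equivariant resolution of log regular schemes — the named fact
# `IllusieTemkin2014_equivariantLogRegularResolution` is a theorem

Topic: `Literature/AlgebraicGeometry/Resolution`. The named fact of
`LogRegularEquivariantResolution.lean` (Illusie–Temkin, in Illusie–Laszlo–Orgogozo, Astérisque
363–364 (2014), Exp. VIII, 3.4.9 / 3.4.15 — the monoidal desingularisation functor, whose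
functoriality yields equivariance; Kato 1994 (10.4); Nizioł 2006 Thm. 5.10, proof: subdividing
functions invariant under the finite groups of cone automorphisms) in the weak form vendored
there: for a quasi-compact integral scheme `Z` with a log regular Zariski fs atlas `𝒜` and a
finite group `G` acting through `ρ : G →* Aut Z` by log automorphisms of `𝒜`, there are a scheme
`X'`, an action `ρ' : G →* Aut X'` and a `G`-equivariant proper birational `r : X' → Z` with `X'`
regular, such that finite subsets of `X'` lie in affine opens whenever those of `Z` do.

PROOF (OURS, assembling the tree). `r` is ONE blowing up `Bl_J Z → Z` along a `G`-STABLE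
quasi-coherent ideal sheaf `J` with regular blow-up charts:
1. `𝒜` is refined by a `LogRegularAtlas` `ℬ` with the same stalk monoids, which every `ρ g`
   respects (`LogAtlas.IsLogRegular.exists_logRegularAtlas_respects`,
   `LogRegularAtlasTranslate.lean`);
2. the translates `(ρ g)^* φ_i` of its charts form one log regular atlas (`LogRegularAtlas.translate`);
   the regular projective subdivision of [KempfEtAl1973] Ch. II §2 Thm. 11* for the ORIGINAL family
   of chart fans, linked by ALL links of the translated atlas (`Fan.linkedRegularRefinementFamily_holds`),
   gives chart monomials `s_i` constant along the translates, compatible on overlaps, with regular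
   blow-up charts by Kato (10.3) (`LogRegularAtlas.exists_compatible_regular_charts_translate`,
   `LogRegularEquivariantCharts.lean`);
3. the chart ideals glue to `J`, stable under the `ρ g` (checked on stalks), and `Bl_J Z → Z` is
   a resolution of singularities (`LogRegularAtlas.exists_stable_resolution`,
   `LogRegularEquivariantIdeal.lean`; Görtz–Wedhorn Prop. 13.91/13.92, (13.19));
4. the action lifts to the blowing up of a stable centre (`IsBlowup.liftAction`,
   `BlowupsEquivariant.lean`, GW Prop. 13.91 (1)), and blowing ups carry finite subsets in affine
   opens to finite subsets in affine opens (`blowup.exists_isAffineOpen_finset_subset`, graded prime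
   avoidance on `Proj` of the Rees algebra; Liu Prop. 3.3.36 (b)).
The integrality hypothesis of the fact is not used.

* `IllusieTemkin2014_equivariantLogRegularResolution_holds` — **the named fact holds.**

References: [IllusieTemkin2014ExpVIII] Thm. 3.4.9, 3.4.15; [IllusieLaszloOrgogozo2014] Exp. VIII
§3.4; [Kato1994] (9.8), (10.3), (10.4); [Niziol2006] Thm. 5.8, 5.10; [KempfEtAl1973] Ch. II §2
Thm. 11*; [GortzWedhorn2020] Prop. 13.91, 13.92, (13.19); [Liu2002] Prop. 3.3.36 (b).
-/

noncomputable section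

open AlgebraicGeometry CategoryTheory TopologicalSpace Opposite

namespace Literature.AlgebraicGeometry.Resolution

universe w u

/-! ## Log automorphisms carry stalk monoids to stalk monoids -/

/-- For an isomorphism of schemes the stalk maps are bijective. [folklore] -/
private theorem stalkMap_bijective_of_isIso' {X Y : Scheme.{u}} (f : X ⟶ Y) [IsIso f] (x : X) :
    Function.Bijective (f.stalkMap x).hom :=
  ConcreteCategory.bijective_of_isIso (f.stalkMap x)

namespace LogAtlas

variable {X : Scheme.{u}} (𝒜 : LogAtlas.{w} X)

/-- **An action by log automorphisms respects the stalk monoids**: if `ρ : G →* Aut X` acts by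
log automorphisms of the atlas `𝒜` (`IsLogEquivariant`: chart elements at `g x` pull back to unit
multiples of chart elements at `x` and conversely), then for `x ∈ U_i`, `g x ∈ U_j` the stalk
isomorphism `(ρ g)_x^*` carries the stalk monoid `𝒪^× · φ_j(P_j)` at `g x` onto the stalk monoid
`𝒪^× · φ_i(P_i)` at `x`. [cite: Kato1994, (1.5)–(1.6)] -/
theorem IsLogEquivariant.map_chartStalkMonoid_eq (𝒜₀ : LogAtlas.{u} X) {G : Type*} [Group G]
    {ρ : G →* Aut X} (h : 𝒜₀.IsLogEquivariant ρ) (g : G) (i j : 𝒜₀.ι) (x : X) (hi : x ∈ 𝒜₀.U i)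
    (hj : (ρ g).hom.base x ∈ 𝒜₀.U j) :
    (chartStalkMonoid (𝒜₀.U j) (𝒜₀.chart j) ((ρ g).hom.base x) hj).map
        ((ρ g).hom.stalkMap x).hom.toMonoidHom =
      chartStalkMonoid (𝒜₀.U i) (𝒜₀.chart i) x hi := by
  rw [← chartStalkMonoid_comp_app (ρ g).hom (𝒜₀.U j) (𝒜₀.chart j) x hj
    (stalkMap_bijective_of_isIso' _ x)]
  obtain ⟨h1, h2⟩ := h g i j x hi hj
  apply le_antisymm
  · refine chartStalkMonoid_le_of_forall_associated _ _ x hj hi fun q => ?_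
    obtain ⟨p, hp⟩ := h1 (Multiplicative.toAdd q)
    refine ⟨Multiplicative.ofAdd p, ?_⟩
    rw [ofAdd_toAdd] at hp
    simp only [MonoidHom.coe_comp, Function.comp_apply, RingHom.toMonoidHom_eq_coe,
      MonoidHom.coe_coe]
    rw [← Scheme.Hom.germ_stalkMap_apply]
    exact hp.symm
  · refine chartStalkMonoid_le_of_forall_associated _ _ x hi hj fun p => ?_
    obtain ⟨q, hq⟩ := h2 (Multiplicative.toAdd p)
    refine ⟨Multiplicative.ofAdd q, ?_⟩
    rw [ofAdd_toAdd] at hq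
    simp only [MonoidHom.coe_comp, Function.comp_apply, RingHom.toMonoidHom_eq_coe,
      MonoidHom.coe_coe]
    rw [← Scheme.Hom.germ_stalkMap_apply]
    exact hq

/-! ## A `LogRegularAtlas` with prescribed stalk monoids -/

/-- On an affine open, every prime ideal of the ring of sections is the prime of a point.
[folklore] -/
private theorem exists_primeIdealOf_eq' {V : X.Opens} (hV : IsAffineOpen V) (𝔭 : Ideal Γ(X, V))
    [𝔭.IsPrime] : ∃ y : V, hV.primeIdealOf y = ⟨𝔭, inferInstance⟩ :=
  ⟨⟨hV.fromSpec ⟨𝔭, inferInstance⟩, hV.range_fromSpec.le ⟨_, rfl⟩⟩, by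
    apply hV.fromSpec.isOpenEmbedding.injective
    rw [hV.fromSpec_primeIdealOf]⟩

/-- **A log regular `LogAtlas` on a quasi-compact scheme is refined by a `LogRegularAtlas` with the
same stalk monoids** (the construction of `LogAtlas.IsLogRegular.nonempty_logRegularAtlas`:
restrict the charts to affine neighbourhoods and take a finite subcover — here remembering that
every chart of the result has, at each of its points, the stalk monoid of the given atlas).
[cite: Kato1994, (1.5) and Def. (2.1)] -/
theorem IsLogRegular.exists_logRegularAtlas_chartStalkMonoid_eq [CompactSpace X]
    (h : 𝒜.IsLogRegular) :
    ∃ ℬ : LogRegularAtlas X, ∀ (i : ℬ.ι) (j : 𝒜.ι) (y : X) (hi : y ∈ (ℬ.U i : X.Opens))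
      (hj : y ∈ 𝒜.U j),
      chartStalkMonoid (ℬ.U i : X.Opens) (ℬ.φ i) y hi = chartStalkMonoid (𝒜.U j) (𝒜.chart j) y hj := by
  haveI := h.isLocallyNoetherian
  choose i hi using 𝒜.exists_mem
  let M : ∀ x : X, Submonoid (X.presheaf.stalk x) := fun x =>
    chartStalkMonoid (𝒜.U (i x)) (𝒜.chart (i x)) x (hi x)
  -- a local chart with stalk monoids `M` at every point
  have hc : ∀ x : X, Nonempty (LocalLogRegularChart X M x) := by
    intro x
    obtain ⟨V, hV, hxV, hVU⟩ := exists_isAffineOpen_mem_and_subset (hi x)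
    replace hVU : V ≤ 𝒜.U (i x) := hVU
    refine ⟨{ U := ⟨V, hV⟩
              mem := hxV
              n := 𝒜.rk (i x)
              P := 𝒜.P (i x)
              φ := (X.presheaf.map (homOfLE hVU).op).hom.toMonoidHom.comp (𝒜.chart (i x))
              fg := 𝒜.fg _
              saturated := 𝒜.saturated' (i x)
              span_eq_top := 𝒜.span_eq_top _
              isLogRegularAt := fun 𝔭 _ => ?_
              chartStalkMonoid_eq := fun y hy => ?_ }⟩
    · obtain ⟨y, hy⟩ := exists_primeIdealOf_eq' hV 𝔭
      have key := (𝒜.isLogRegularLocal_stalkChart_iff (i x) hV hVU y.1 y.2).1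
        (h.isLogRegularLocal (i x) y.1 (hVU y.2))
      rw [hy] at key
      exact key
    · change chartStalkMonoid V _ y hy = chartStalkMonoid (𝒜.U (i y)) (𝒜.chart (i y)) y (hi y)
      rw [chartStalkMonoid_comp_map]
      exact 𝒜.chartStalkMonoid_eq (i x) (i y) y _ _
  let c : ∀ x, LocalLogRegularChart X M x := fun x => Classical.choice (hc x)
  obtain ⟨s, hs⟩ := isCompact_univ.elim_finite_subcover
    (fun x : X => (((c x).U : X.Opens) : Set X)) (fun x => ((c x).U : X.Opens).isOpen)
    (fun x _ => Set.mem_iUnion.mpr ⟨x, (c x).mem⟩)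
  obtain ⟨m, ⟨e⟩⟩ := Finite.exists_equiv_fin (s : Set X)
  have hcov : ⨆ k : Fin m, ((c (e.symm k).1).U : X.Opens) = ⊤ := by
    refine top_le_iff.mp fun x _ => ?_
    have hx := hs (Set.mem_univ x)
    simp only [Set.mem_iUnion] at hx
    obtain ⟨y, hy, hxy⟩ := hx
    exact Opens.mem_iSup.mpr ⟨e ⟨y, hy⟩, by rw [Equiv.symm_apply_apply]; exact hxy⟩
  refine ⟨{ ι := Fin m
            finite := inferInstance
            U := fun k => (c (e.symm k).1).U
            iSup_eq_top := hcov
            isNoetherianRing := fun k => IsLocallyNoetherian.component_noetherian _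
            n := fun k => (c (e.symm k).1).n
            P := fun k => (c (e.symm k).1).P
            fg := fun k => (c _).fg
            saturated := fun k => (c _).saturated
            span_eq_top := fun k => (c _).span_eq_top
            φ := fun k => (c (e.symm k).1).φ
            isLogRegularAt := fun k 𝔭 _ => (c _).isLogRegularAt 𝔭
            compat := fun k l x hk hl => by
              rw [(c _).chartStalkMonoid_eq, (c _).chartStalkMonoid_eq] }, fun k j y hk hj => ?_⟩
  change chartStalkMonoid ((c (e.symm k).1).U : X.Opens) (c (e.symm k).1).φ y hk = _
  rw [(c _).chartStalkMonoid_eq]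
  exact 𝒜.chartStalkMonoid_eq (i y) j y _ _

end LogAtlas

/-! ## From an equivariant log regular `LogAtlas` to a translated `LogRegularAtlas` -/

/-- **Equivariant input, atlas output.** For a log regular `LogAtlas` `𝒜` on a quasi-compact `X`
and an action `ρ : G →* Aut X` by log automorphisms of `𝒜`, there is a `LogRegularAtlas` `ℬ` all of
whose stalk monoids are those of `𝒜` and which every `ρ g` respects
(`LogRegularAtlas.RespectsStalkMonoids`) — so that `ℬ.translate` applies to any finite family of
the `ρ g`. [cite: Kato1994, (1.5)–(1.6) and Def. (2.1)] -/
theorem LogAtlas.IsLogRegular.exists_logRegularAtlas_respects {X : Scheme.{u}} [CompactSpace X]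
    {𝒜 : LogAtlas.{u} X}
    (h : 𝒜.IsLogRegular) {G : Type*} [Group G] {ρ : G →* Aut X} (hρ : 𝒜.IsLogEquivariant ρ) :
    ∃ ℬ : LogRegularAtlas X, ∀ g : G, ℬ.RespectsStalkMonoids (ρ g) := by
  obtain ⟨ℬ, hℬ⟩ := h.exists_logRegularAtlas_chartStalkMonoid_eq
  refine ⟨ℬ, fun g x i j hi hj => ?_⟩
  obtain ⟨i', hi'⟩ := 𝒜.exists_mem x
  obtain ⟨j', hj'⟩ := 𝒜.exists_mem ((ρ g).hom.base x)
  rw [hℬ j j' _ hj hj', hℬ i i' x hi hi']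
  exact hρ.map_chartStalkMonoid_eq 𝒜 g i' j' x hi' hj'

/-! ## The named fact holds -/

/-- **Equivariant resolution of log regular schemes (Illusie–Temkin 2014, Exp. VIII 3.4.9, weak
form; Kato 1994 (10.4); Nizioł 2006 Thm. 5.10) — the named fact
`IllusieTemkin2014_equivariantLogRegularResolution` holds.** For a quasi-compact integral `Z` with
a log regular Zariski fs atlas `𝒜` and a finite group `G` acting through `ρ : G →* Aut Z` by log
automorphisms of `𝒜`: a scheme `X'` with an action `ρ'` of `G` and a `G`-equivariant proper
birational `r : X' → Z` with `X'` regular, finite subsets of `X'` lying in affine opens if those of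
`Z` do. Proof: the blowing up of `Z` along the `G`-stable resolving ideal sheaf of
`LogRegularAtlas.exists_stable_resolution` (applied to the translated atlas for the family
`k ↦ ρ (e⁻¹ k)`, `e : G ≃ Fin m`), with the lifted action `IsBlowup.liftAction`.
[cite: IllusieTemkin2014ExpVIII, Thm. 3.4.9 and 3.4.15, pp. 103–160]
[cite: Kato1994, (10.4) with (9.8), (10.3)] [cite: Niziol2006, Thm. 5.8 and Thm. 5.10 (proof)]
[cite: GortzWedhorn2020, Prop. 13.91 (1), Prop. 13.92] [cite: Liu2002, Prop. 3.3.36 (b)] -/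
theorem IllusieTemkin2014_equivariantLogRegularResolution_holds :
    IllusieTemkin2014_equivariantLogRegularResolution.{u} := by
  intro Z 𝒜 G _ _ ρZ _ hc h𝒜 hρ
  classical
  haveI := hc
  -- a `LogRegularAtlas` with the same stalk monoids, respected by the action
  obtain ⟨ℬ, hℬ⟩ := h𝒜.exists_logRegularAtlas_respects hρ
  -- index the group by `Fin m`
  obtain ⟨m, ⟨e⟩⟩ := Finite.exists_equiv_fin G
  haveI : Nonempty (Fin m) := ⟨e 1⟩
  let σ : Fin m → Aut Z := fun k => ρZ (e.symm k)
  have hσ : ∀ k, ℬ.RespectsStalkMonoids (σ k) := fun k => hℬ (e.symm k)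
  have hcl : ∀ k k' : Fin m, ∃ k'', (σ k'').hom = (σ k).hom ≫ (σ k').hom := fun k k' =>
    ⟨e (e.symm k' * e.symm k), by
      simp only [σ, Equiv.symm_apply_apply, map_mul, Aut.Aut_mul_def, Iso.trans_hom]⟩
  -- the stable resolving ideal sheaf and its blowing up
  obtain ⟨J, hJσ, hres⟩ := ℬ.exists_stable_resolution σ hσ hcl
  have hJρ : ∀ g : G, J.comap (ρZ g).hom = J := fun g => by
    have h := hJσ (e g)
    simp only [σ, Equiv.symm_apply_apply] at h
    exact h
  exact ⟨blowup J, (blowup.isBlowup J).liftAction ρZ hJρ, blowup.π J, hres.isProper,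
    hres.isBirational, hres.isRegular, fun g => (blowup.isBlowup J).liftAction_hom_comp ρZ hJρ g,
    fun hfin S => blowup.exists_isAffineOpen_finset_subset J hfin S⟩

/-- **Corollary (consistency, now unconditional): every quasi-compact integral scheme with a log
regular Zariski fs atlas has a resolution of singularities** — Kato 1994 (10.4), recovered from the
equivariant theorem with the trivial group
(`IllusieTemkin2014_equivariantLogRegularResolution.hasResolution`). [cite: Kato1994, (10.4)] -/
theorem hasResolution_of_isLogRegular_of_equivariant {Z : Scheme.{u}} [IsIntegral Z]
    [CompactSpace Z] {𝒜 : LogAtlas.{u} Z} (h𝒜 : 𝒜.IsLogRegular) : Scheme.HasResolution Z :=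
  IllusieTemkin2014_equivariantLogRegularResolution_holds.hasResolution h𝒜

end Literature.AlgebraicGeometry.Resolution

end
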